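import Summits.QuantumFields.YangMills.Theorems.BalabanUVNodesN15FullPropagatorByPartsNode
import Summits.QuantumFields.YangMills.Theorems.BalabanUVNodesN15FullPropagatorTgKnit

/-!
# Route «BalabanUVNodes», cluster K4 «SpineRates» — node N15 = NE2: `N15At` WITH THE OPERATOR LAYER's BACKGROUND BLOCK LIVE — dag-n15-c's FILE-8 BY-PARTS FAMILY
# (`ne2PlusOperator_fullG_byParts`: Bałaban's full `U ≡ 1` propagator dressed by a live first-order scalar background) THROUGH THE GENERIC KNIT (part 78), its
# `NE2Objects₁₁` literal and keyed-home faces (dag-n15-c g8 «YES please … the record faces are yours», INBOX l.21699 (3))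

Cell `pub-ymgap`, seat `pub-ymgap-dag-n15-a` (-a KNIT-BY-NAME seat of node N15; HUMAN RULING D-0062; chair R424 venue), generation 15, part 79 (two data `def`s — an index
sub-type and one `NE2Objects₁₁` literal —, the rest theorems; 0 `sorry`).  `bears_on: R4∕N15 · K3⁷ SpineGivenEndpointR13SepCoPH (stmt-QuantumFields-20544; dag-lead
WORDS-143)`.  Filed `--kind proof --supports stmt-QuantumFields-20544 --as helper` — COUNT-NEUTRAL.  Imports dag-n15-c FILE 8 `…N15FullPropagatorByPartsNode` (p550477 ✓:
`fgInstance`, `fgFamily`, ★★★ `ne2PlusOperator_fullG_byParts`) and this seat's part 78 `…N15FullPropagatorTgKnit` (`tgSiteOn`, `tgCovOn`, ★★★ `n15At_tg_of_ne2PlusOperator`);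
nothing in the tree is modified.

WHAT.  ONE application of the generic knit: dag-n15-c's realised by-parts paired instances `fgInstance d hL γ_d i` (`γ_d = 1∕(8(d+1))`) ARE of the form
`⟨tgGeoC d hL i.1, fineGeo …, coeffBgBP …, coeffBgBP …, bgPairingBP …⟩` (FILE 7a `bgInstanceBP`), so part 78 applies with `ι = Prod.fst`, the by-parts fine geometry ∕
background carriers ∕ pairing read off the instance, and `Kop := fgFamily d hL b γ_d`:
* §1 abbrev `FGIndexL d := {i : TGIndex × Fin (d+1) ∕∕ 1 ≤ i.1.mT}` (L-divisible tori), `fgIndexL_nonempty`; ★★★ **`n15At_fullG_byParts`**: for `d ≥ 1`, odd `L ≥ 3`,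
  `b, a_S > 0`, `c₃₅ > 0`, directions `α β`, every `p`:
  `N15At ⟨FGIndexL d, c₃₅, p, fgInstance γ_d ∘ val, fgFamily b γ_d ∘ val, tgSiteOn a_S (fst ∘ val) (Bf ∘ …), tgCovOn α β (fst ∘ val) (Bf ∘ …), ⊤, dist⟩` — OPERATOR = FILE 8
  (background block LIVE: the (3.35)–(3.36) letters of `coeffBgBP` are consumed in dag-n15-c's proof), re-indexed by `NE2NodeTorus.ne2PlusOperator_reindex val`; SITE ∕ UNIT =
  the two `U ≡ 1` kernels (G1's `(Q′G′²Q′*)⁻¹`, [B6] (2.156) `C^{(k)}_Λ`), blind to the background — their «+» idle, said; NO displayed binder, NO weight window;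
* §2 def `byPartsObjects d hL b a_S α β c₃₅ p : Node00.NE2Objects₁₁`, `ne2OfRecord₁₁_byPartsObjects` (rfl), `n15At_byPartsObjects` (`c₃₅ > 0`), `populated_byPartsObjects`;
* §3 keyed-home faces (part 30's interface): `s_N15_of_admits_byParts`, ★★ `s_N15_of_admits_byParts_family` (`fgInstance 3 F.hL`, block factor `F.L`),
  `populated_byPartsObjects_family` — the v1.7 `CoPH` homes instantiate them in the companion part 80.
dag-n15-c's announced slimmer ∕ primitive carriers (`fgInstanceSlim`, `fgInstanceC2`, INTENT-8∕10) have the same coarse geometry: their `N15At` is the same ONE application of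
part 78 (theirs or a successor's to file).

HONEST FRAMING.  Count-neutral kernel composition BY NAME; no new estimate (FILE 8, G1, `T4Cov2156Rate`).  WHAT THE FAMILY IS: operator layer = Bałaban's full `U ≡ 1`
Landau-gauge propagator `G = Δ_b⁻¹` dressed by a LIVE first-order SCALAR background (dag-n15-c's species: abelianised coefficients, block-averaged coarse partner, rate number
`(L^k)^{−γ_d}` in the carrier — MODEL-LEVEL in the background, GENUINE in the propagator; NOT Bałaban's non-abelian `V′(A)` of (3.52)∕(3.60)); site ∕ unit layers = the `U ≡ 1`
objects, which do not see the background; [B9] size parameter `gf.M` = the unit-torus carrier's `1`; rates sup-block-currency artefacts.  WHAT IT IS NOT: NOT [B9] Thms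
3.1∕3.2∕3.15 at a general (3.35)-regular `U` (NE2⁺ proper — NOT PRINTED as η-rates), NOT Node 00's [B9] operator layer of record (residual) — **N15 is NOT discharged** (typed
28∕28 · discharged 5∕27 of record unchanged); one finite four-torus programme at fixed `ε` — NOT ℝ⁴, NOT infinite volume, NOT OS, NOT a mass gap, NOT Clay.  Restate-immune.
-/

set_option autoImplicit false

noncomputable section
namespace Summit.QuantumFields.YangMills.BalabanUVNodes.N15.GenuineRecord

open Literature.MathematicalPhysics.QuantumFieldTheory.Balaban1983to89
open Literature.MathematicalPhysics.QuantumFieldTheory.Balaban1983to89.T4Continuum (T4Family ULoop)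
open Literature.MathematicalPhysics.QuantumFieldTheory.Balaban1983to89.T4EtaRate (PairedInstance NE2PlusOperator NE2PlusSite NE2PlusUnit)
open Literature.MathematicalPhysics.QuantumFieldTheory.Balaban1983to89.NE2NodeTorus (ne2PlusOperator_reindex)
open Node00 (NE2Objects₁₁)
open Summit.QuantumFields.BalabanUV.T4Continuum.HistoryFlow (two_le_L)
open Summit.QuantumFields.YangMills.BalabanUVNodes.N15.TwoGrid (TGIndex tgGeoC)
open Summit.QuantumFields.YangMills.BalabanUVNodes.N15.BackgroundLayer (fgInstance fgFamily ne2PlusOperator_fullG_byParts)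
open Summit.QuantumFields.YangMills.BalabanUVNodes.N15.AtKeyedHome (s_N15_of_admits neZero_blockFactor)
open YMDAG.UVSplit (Datum NE2Carriers RateCarriers RateRecordPred N15At S_N15 ne2OfRecord₁₁)

variable {d : ℕ} {L : ℕ} [NeZero L]

/-! ## §1 The L-divisible by-parts sub-index and `N15At` for FILE 8's family -/

/-- THE L-DIVISIBLE SUB-INDEX of dag-n15-c's by-parts family: indices `((m_T, k ≥ 1, m), ν)` with torus exponent `m_T ≥ 1` (periods `M_μ = 2L^{m_T}` divisible by `L`, where
the (2.156) covariance exists). [cite: Balaban1984PropagatorsII, (2.152)–(2.156) pp.249–250 (object: the torus of L-blocks)] -/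
abbrev FGIndexL (d : ℕ) : Type := {i : TGIndex × Fin (d + 1) // 1 ≤ i.1.mT}

/-- NON-VACUITY: `FGIndexL d` carries `((1, 1, 0), 0)`. [folklore] -/
theorem fgIndexL_nonempty : Nonempty (FGIndexL d) := ⟨⟨(⟨1, 1, le_rfl, 0⟩, 0), le_rfl⟩⟩

/-- ★★★ **`N15At` — ALL THREE CONJUNCTS BY NAME, NO DISPLAYED BINDER — FOR dag-n15-c's BY-PARTS FAMILY: Bałaban's full `U ≡ 1` Landau-gauge propagator DRESSED BY A LIVE
FIRST-ORDER SCALAR BACKGROUND in the operator layer; the genuine site kernel and the (2.156) covariance (blind to the background) in the other two.**  For `d ≥ 1`, odd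
`L ≥ 3`, `b, a_S > 0`, `c₃₅ > 0`, directions `α β`, every `p`, at `γ_d = 1∕(8(d+1))` — ONE application of part 78 `n15At_tg_of_ne2PlusOperator` to FILE 8's
`ne2PlusOperator_fullG_byParts` (re-indexed to the L-divisible sub-index). [bookkeeping] -/
theorem n15At_fullG_byParts (hd : 1 ≤ d) (hLodd : Odd L) (hL2 : 2 ≤ L) (hL : Odd L ∧ 1 < L) {b aS : ℝ} (hb : 0 < b) (haS : 0 < aS) {c35 : ℝ} (hc35 : 0 < c35)
    (α β : Fin (d + 1)) (p : ℝ) :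
    N15At { I := FGIndexL d, c35 := c35, p := p, pi := fun i => fgInstance d hL (1 / (8 * ((d : ℝ) + 1))) i.1,
            Kop := fun i => fgFamily d hL b (1 / (8 * ((d : ℝ) + 1))) i.1,
            Ksite := tgSiteOn d hL aS (fun i : FGIndexL d => i.1.1) (fun i => (fgInstance d hL (1 / (8 * ((d : ℝ) + 1))) i.1).Bf),
            Kunit := tgCovOn d hL α β (fun i : FGIndexL d => i.1.1) (fun i => (fgInstance d hL (1 / (8 * ((d : ℝ) + 1))) i.1).Bf),
            inΛ := fun _ _ => True, unitDist := fun i => (tgGeoC d hL i.1.1).dist } :=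
  n15At_tg_of_ne2PlusOperator (d := d) (fun i : FGIndexL d => i.1.1) (fun i => (fgInstance d hL (1 / (8 * ((d : ℝ) + 1))) i.1).gf)
    (fun i => (fgInstance d hL (1 / (8 * ((d : ℝ) + 1))) i.1).Bc) (fun i => (fgInstance d hL (1 / (8 * ((d : ℝ) + 1))) i.1).Bf)
    hd hLodd hL2 hL haS α β (fun i => i.2) (fun i => (fgInstance d hL (1 / (8 * ((d : ℝ) + 1))) i.1).pair) p
    (fun i => fgFamily d hL b (1 / (8 * ((d : ℝ) + 1))) i.1)
    (ne2PlusOperator_reindex (Subtype.val : FGIndexL d → TGIndex × Fin (d + 1)) (ne2PlusOperator_fullG_byParts d hd hLodd hL2 hL hb c35 hc35))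

/-! ## §2 The by-parts family as N15's `NE2Objects₁₁` literal -/

/-- **N15's NE2 OBJECTS OF THE BY-PARTS FAMILY** (RR-1's layer-A container): index `FGIndexL d`, letters `c₃₅`, `p`, dag-n15-c's realised by-parts instances `fgInstance d hL γ_d`
(coarse∕fine unit-torus carriers, King's pairing, coefficient backgrounds with the (3.35)–(3.36) letter shapes), OPERATOR kernels `fgFamily b γ_d` (full `U ≡ 1` propagator dressed
by the live first-order scalar background, all four (3.42) entries), SITE `tgSiteOn a_S` (G1's kernel), UNIT `tgCovOn α β` ((2.156)), region `⊤`, unit distance = the carrier's.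
[bookkeeping] -/
def byPartsObjects (d : ℕ) (hL : Odd L ∧ 1 < L) (b aS : ℝ) (α β : Fin (d + 1)) (c35 p : ℝ) : NE2Objects₁₁ where
  I := FGIndexL d
  c35 := c35
  p := p
  pi := fun i => fgInstance d hL (1 / (8 * ((d : ℝ) + 1))) i.1
  Kop := fun i => fgFamily d hL b (1 / (8 * ((d : ℝ) + 1))) i.1
  Ksite := tgSiteOn d hL aS (fun i : FGIndexL d => i.1.1) (fun i => (fgInstance d hL (1 / (8 * ((d : ℝ) + 1))) i.1).Bf)
  Kunit := tgCovOn d hL α β (fun i : FGIndexL d => i.1.1) (fun i => (fgInstance d hL (1 / (8 * ((d : ℝ) + 1))) i.1).Bf)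
  inΛ := fun _ _ => True
  unitDist := fun i => (tgGeoC d hL i.1.1).dist

/-- The home's NE2 bundle of the by-parts objects IS §1's record (`rfl`). [bookkeeping] -/
theorem ne2OfRecord₁₁_byPartsObjects (hL : Odd L ∧ 1 < L) (b aS : ℝ) (α β : Fin (d + 1)) (c35 p : ℝ) :
    ne2OfRecord₁₁ (byPartsObjects d hL b aS α β c35 p) =
      { I := FGIndexL d, c35 := c35, p := p, pi := fun i => fgInstance d hL (1 / (8 * ((d : ℝ) + 1))) i.1,
        Kop := fun i => fgFamily d hL b (1 / (8 * ((d : ℝ) + 1))) i.1,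
        Ksite := tgSiteOn d hL aS (fun i : FGIndexL d => i.1.1) (fun i => (fgInstance d hL (1 / (8 * ((d : ℝ) + 1))) i.1).Bf),
        Kunit := tgCovOn d hL α β (fun i : FGIndexL d => i.1.1) (fun i => (fgInstance d hL (1 / (8 * ((d : ℝ) + 1))) i.1).Bf),
        inΛ := fun _ _ => True, unitDist := fun i => (tgGeoC d hL i.1.1).dist } := rfl

/-- ★★★ **`N15At` AT THE BY-PARTS OBJECTS' BUNDLE** (`c₃₅ > 0`; §1 read through `ne2OfRecord₁₁`). [bookkeeping] -/
theorem n15At_byPartsObjects (hd : 1 ≤ d) (hLodd : Odd L) (hL2 : 2 ≤ L) (hL : Odd L ∧ 1 < L) {b aS : ℝ} (hb : 0 < b) (haS : 0 < aS) {c35 : ℝ} (hc35 : 0 < c35)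
    (α β : Fin (d + 1)) (p : ℝ) : N15At (ne2OfRecord₁₁ (byPartsObjects d hL b aS α β c35 p)) :=
  n15At_fullG_byParts (d := d) hd hLodd hL2 hL hb haS hc35 α β p

/-- **RR-1's DISPLAY HOLDS AT THE BY-PARTS LITERAL**: `Populated`. [bookkeeping] -/
theorem populated_byPartsObjects (hL : Odd L ∧ 1 < L) (b aS : ℝ) (α β : Fin (d + 1)) (c35 p : ℝ) :
    (byPartsObjects d hL b aS α β c35 p).Populated :=
  (NE2Objects₁₁.populated_iff _).2 fgIndexL_nonempty

/-! ## §3 The keyed-home faces: a home admitting the by-parts literals has `S_N15`, no estimate displayed -/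

section KeyedHome

variable {N : ℕ} [NeZero N] {key : (F : T4Family) → Datum F N → Prop}

/-- ★★ **THE BY-PARTS READING CLOSES THE STUB AT ANY KEYED HOME** (part 30's interface): `d ≥ 1`, odd `L ≥ 3`, `b, a_S > 0`, `c₃₅ > 0`, `α β`, `p`: a rate home `RRec` over ANY
key admitting only the literals of a key-indexed NE2 reading valued in `byPartsObjects d hL b a_S α β c₃₅ p` has `S_N15 RRec` — the estimate is §1 (operator layer with the
background block LIVE), not a hypothesis. [bookkeeping] -/
theorem s_N15_of_admits_byParts (hd : 1 ≤ d) (hLodd : Odd L) (hL2 : 2 ≤ L) (hL : Odd L ∧ 1 < L) {b aS : ℝ} (hb : 0 < b) (haS : 0 < aS) {c35 : ℝ} (hc35 : 0 < c35)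
    (α β : Fin (d + 1)) (p : ℝ)
    (ne2At : ∀ {F : T4Family} {D : Datum F N}, key F D → (ℕ → ℝ) → List (ULoop F) → ℕ → NE2Objects₁₁) (RRec : RateRecordPred N)
    (hadm : ∀ (F : T4Family) (D : Datum F N) (g₀ : ℕ → ℝ) (os : List (ULoop F)) (R : RateCarriers N), RRec F D g₀ os R →
      ∃ (h : key F D) (k : ℕ), R.ne2 = ne2OfRecord₁₁ (ne2At h g₀ os k))
    (h : ∀ (F : T4Family) (D : Datum F N) (h : key F D) (g₀ : ℕ → ℝ) (os : List (ULoop F)) (k : ℕ), ne2At h g₀ os k = byPartsObjects d hL b aS α β c35 p) :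
    S_N15 RRec := by
  refine s_N15_of_admits ne2At RRec hadm fun F D hk g₀ os k => ?_
  rw [h F D hk g₀ os k]
  exact n15At_byPartsObjects (d := d) hd hLodd hL2 hL hb haS hc35 α β p

/-- ★★ **THE FAMILY-KEYED BY-PARTS READING CLOSES THE STUB AT ANY KEYED HOME** (`d + 1 = 4`; the reading reads the datum's family: `fgInstance 3 F.hL`, block factor `F.L`).
[bookkeeping] -/
theorem s_N15_of_admits_byParts_family {b aS : ℝ} (hb : 0 < b) (haS : 0 < aS) {c35 : ℝ} (hc35 : 0 < c35) (α β : Fin 4) (p : ℝ)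
    (ne2At : ∀ {F : T4Family} {D : Datum F N}, key F D → (ℕ → ℝ) → List (ULoop F) → ℕ → NE2Objects₁₁) (RRec : RateRecordPred N)
    (hadm : ∀ (F : T4Family) (D : Datum F N) (g₀ : ℕ → ℝ) (os : List (ULoop F)) (R : RateCarriers N), RRec F D g₀ os R →
      ∃ (h : key F D) (k : ℕ), R.ne2 = ne2OfRecord₁₁ (ne2At h g₀ os k))
    (h : ∀ (F : T4Family) (D : Datum F N) (h : key F D) (g₀ : ℕ → ℝ) (os : List (ULoop F)) (k : ℕ),
      ne2At h g₀ os k = haveI := neZero_blockFactor F; byPartsObjects 3 F.hL b aS α β c35 p) :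
    S_N15 RRec := by
  refine s_N15_of_admits ne2At RRec hadm fun F D hk g₀ os k => ?_
  rw [h F D hk g₀ os k]
  haveI := neZero_blockFactor F
  exact n15At_byPartsObjects (d := 3) (by norm_num) F.hL.1 (two_le_L F) F.hL hb haS hc35 α β p

/-- **RR-1's DISPLAY AT THE FAMILY-KEYED BY-PARTS LITERAL**. [bookkeeping] -/
theorem populated_byPartsObjects_family (F : T4Family) (b aS : ℝ) (α β : Fin 4) (c35 p : ℝ) :
    (haveI := neZero_blockFactor F; byPartsObjects 3 F.hL b aS α β c35 p).Populated := by
  haveI := neZero_blockFactor F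
  exact populated_byPartsObjects F.hL b aS α β c35 p

end KeyedHome

end Summit.QuantumFields.YangMills.BalabanUVNodes.N15.GenuineRecord

end
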